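import Summits.QuantumFields.YangMills.Theorems.UV3BranchExpansionHTopSegmentSU2Ranges
import Summits.QuantumFields.YangMills.Theorems.UV3BranchExpansionHaarBallSharpRecord
import Summits.QuantumFields.YangMills.Theorems.UV3BranchExpansionCountingSmallnessT3
import Summits.QuantumFields.YangMills.Theorems.UV3BranchExpansionHTopT3L3
import HarnessLib

/-!
# `UV3BranchExpansionHTopT3AllL` — hTop, the K-uniform top push-forward bound of the guarded block averaging, for EVERY three-torus family with
# block size `3 ≤ L ≤ 20` (crux `UnitScaleTilt.HistoryTailL`, stmt-QuantumFields-19936 — SUPPLY side: NODE O ∕ N08 ∕ the 19936 faces' `hTopB` letter)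

Cell `ym3-torus` (YM ladder rung R3 = continuum SU(2) Yang–Mills on T³ — a RUNG, NOT d = 4, NOT infinite volume, NOT a mass gap, NOT Clay);
width seat `ym3-torus-px13` (gen 14), explicit-unit helper; `--supports stmt-QuantumFields-19936 --as helper`.  THEOREMS ONLY (0 `def`,
0 `sorry`, default heartbeats, no local `DecidableEq` binder).

WHAT.  w5 g19's ✓`UV3BranchExpansionHTopT3L3.topHaarPushforward_of_L_eq_three` is hTop(F) at `F.L = 3` (px8 g13's segment engine ✓`…HTopSegment` over w8 g12's
socket weight at the `L^{d−1} ≤ 9` constant `K⋆`, this seat's sharp Haar-ball numerals).  THIS FILE does the remaining block sizes the tree's (H_K) suppliers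
reach — `4 ≤ L ≤ 20`, the range `L^{d−1} ≤ 400` of ✓`fibre_law_le_su2_record` — in ONE theorem, and joins the two:
 §1 ★★★ `map_iterFrom_blockAvg_le_exp_smul_allL (F) (h4 : 4 ≤ F.L) (h20 : F.L ≤ 20) (K j n) (hjn : j + n ≤ F.m + K)` : one segment, hypothesis-free —
    w8's ✓`…HTopSegmentSU2Ranges.map_iterFrom_le_exp_smul_su2_record` at `δ′ := 1/21`, `(y, θ₀) := (9/10, (1 + (9/10)^{L−1})/2)`, its activity
    `2W ≤ 10⁻¹⁴` by ✓`UV3BranchExpansionHaarBallSharpRecord.two_mul_kstar_record_mul_ratio_le_letters` (window exponent `L² − 1 ≥ 15`) and its two smallness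
    rows by ✓`UV3BranchExpansionCountingSmallnessT3.smallness_T3_allL_of_ennreal_le`, then monotonicity of the exponent in `x ≤ 10⁻¹⁴`;
 §2 ★★★ `topBlockAvgPushforward_of_le_twenty` ∕ ★★★★ `topHaarPushforward_of_le_twenty (F) (h4) (h20) : ∃ c ≥ 0, ∀ K j n, j + n = K →
    (dU_j).map (iterFrom (avT3 F K) j n) ≤ ofReal (exp c) • dU_{j+n}` (`c = 3·(2L^m)³ · M_L · 10⁻¹⁴/(9/10)^{5(L−1)}`, K-free by w5's ✓`card_pBond_top`);
 §3 ★★★★ `topHaarPushforward_of_three_le (F) (h3 : 3 ≤ F.L) (h20 : F.L ≤ 20)` : hTop for EVERY three-torus family with `3 ≤ L ≤ 20` — w5's `L = 3` ∨ §2;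
    ★★★★ `topHaarPushforward_of_T3_le_twenty (F) (h20 : F.L ≤ 20)` : the same with ONE hypothesis (`3 ≤ F.L` is automatic: `T3Family.hL = Odd L ∧ 1 < L`).

HYP-SAT (OWNER RULING №42 (1)): `h3`∕`h4`∕`h20` are literal ranges of the family's block size; `hjn`∕`j + n = K` literal; NO smallness ∕ (H_K) ∕ admitting
hypothesis is displayed — all discharged by name on the literal T³ families (w8 ✓p762268 `hw_su2_of_pow_le_four_hundred`, this seat's numerals, px8's engine).
Beyond `L = 20` no (H_K) supplier exists in the tree (px13 g14 FINDING, 19936 evidence #60 §2) — said so; `L ≤ 2` is outside every count.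

HONEST SCOPE.  Composition bookkeeping over landed engines and kernel numerals; hTop is SUPPLY (NODE O ∕ N08), not a registry row; nothing of the χ record
`AlphaInputsT3ACv4RecChi`, (O‴χₛ), EX, `HistoryTailL` (19936), `YM3TorusSU2` is proved; the Yang–Mills mass gap is NOT proved.

References: T. Bałaban, CMP **102** (1985) 255–275 [Balaban1985UV3] (2) p. 256, (5) p. 257; [Balaban1987RG1] (0.4) p. 253; LEAD note
`Cruxes/HistoryTailL/HTopBranchExpansion.md` v1.2 §0–§6; px13 g14 evidence #60 (numerics).
-/

set_option autoImplicit false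

noncomputable section

namespace Summit.QuantumFields.YangMills.Theorems.UV3BranchExpansionHTopT3AllL

open MeasureTheory
open scoped ENNReal
open Literature.MathematicalPhysics.QuantumFieldTheory (haarProbability)
open Literature.MathematicalPhysics.QuantumFieldTheory.Balaban1983to89
open Literature.MathematicalPhysics.QuantumFieldTheory.Balaban1983to89.T3ContinuumYM3Torus
open Literature.MathematicalPhysics.QuantumFieldTheory.Balaban1983to89.T3UnitLawDensityEML (ℰp)
open Literature.MathematicalPhysics.QuantumFieldTheory.Balaban1983to89.T4CubeChartGnomonic (SU2)
open Literature.MathematicalPhysics.QuantumFieldTheory.Balaban1983to89.BlockAveraging (blockAvg)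
open Literature.MathematicalPhysics.QuantumFieldTheory.Balaban1983to89.T4AvgSensitivity (iterFrom)
open Summit.QuantumFields.YangMills.Theorems.UV3BranchExpansionHTopSegmentSU2Ranges (map_iterFrom_le_exp_smul_su2_record)
open Summit.QuantumFields.YangMills.Theorems.UV3BranchExpansionHaarBallSharp (haarData_dist1_lt_one_div_ne_zero)
open Summit.QuantumFields.YangMills.Theorems.UV3BranchExpansionHaarBallSharpRecord (two_mul_kstar_record_mul_ratio_le_letters)
open Summit.QuantumFields.YangMills.Theorems.UV3BranchExpansionCountingSmallness (M_pos)
open Summit.QuantumFields.YangMills.Theorems.UV3BranchExpansionCountingSmallnessT3 (smallness_T3_allL_of_ennreal_le theta_allL_lt_one)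
open Summit.QuantumFields.YangMills.Theorems.UV3BranchExpansionHTopT3L3 (card_pBond_top topHaarPushforward_of_L_eq_three)
open Summit.QuantumFields.YangMills.Theorems.UV3PinnedStepOrganOfTopPartialIterates (iterFrom_avT3_eq_iterFrom_blockAvg)

/-! ## §1 One segment of a three-torus family with `4 ≤ L ≤ 20`: no hypothesis but the range -/

/-- ★★★ **hTop FOR ONE SEGMENT OF A THREE-TORUS FAMILY WITH `4 ≤ L ≤ 20`, HYPOTHESIS-FREE.**  For `F : T3Family` with `4 ≤ F.L ≤ 20`, every `K`, every
segment `j + n ≤ m + K`: `(dU_j).map (iterFrom (blockAvg ℰp) j n) ≤ ofReal (exp (#PBond(F.P K, j+n) · M_L · (10⁻¹⁴/(9/10)^{5(L−1)}))) • dU_{j+n}`,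
`M_L = 2/(1 − (1 + (9/10)^{L−1})/2)` — w8's ✓`map_iterFrom_le_exp_smul_su2_record` at `δ′ := 1/21`, `(y, θ₀) := (9/10, (1 + (9/10)^{L−1})/2)`, its activity
`2W ≤ 10⁻¹⁴` by ✓`two_mul_kstar_record_mul_ratio_le_letters` and its two smallness rows by ✓`smallness_T3_allL_of_ennreal_le`, then monotonicity in `x ≤ 10⁻¹⁴`.
[cite: Balaban1987RG1, (0.4) p.253; Balaban1985UV3, (2) p.256] -/
theorem map_iterFrom_blockAvg_le_exp_smul_allL (F : T3Family) (h4 : 4 ≤ F.L) (h20 : F.L ≤ 20) (K j n : ℕ) (hjn : j + n ≤ F.m + K) :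
    (fieldMeasure (F.P K) j (Matrix.specialUnitaryGroup (Fin 2) ℂ)).map
        (iterFrom (fun i => blockAvg (P := F.P K) (G := Matrix.specialUnitaryGroup (Fin 2) ℂ) (j := i) ℰp) j n) ≤
      ENNReal.ofReal (Real.exp (Fintype.card (PBond (F.P K) (j + n)) *
        (2 / (1 - (1 + (9 / 10 : ℝ) ^ (F.L - 1)) / 2) * (1 / 10 ^ 14 / (9 / 10 : ℝ) ^ ((2 * 3 - 1) * (F.L - 1)))))) •
        fieldMeasure (F.P K) (j + n) (Matrix.specialUnitaryGroup (Fin 2) ℂ) := by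
  have hd : (F.P K).d = 3 := rfl
  have hPL : (F.P K).L = F.L := rfl
  have hL400 : (F.P K).L ^ ((F.P K).d - 1) ≤ 400 := by
    rw [hPL, hd]
    calc F.L ^ (3 - 1) ≤ 20 ^ (3 - 1) := Nat.pow_le_pow_left h20 _
      _ = 400 := by norm_num
  have hjn' : j + n ≤ (F.P K).m + (F.P K).K := hjn
  have hθ₀ : (1 + (9 / 10 : ℝ) ^ (F.L - 1)) / 2 < 1 := theta_allL_lt_one h4
  -- the activity `W` at `δ′ = 1/21` and its bound
  set W : ℝ≥0∞ :=
    ((ENNReal.ofReal (((1 / 400 : ℝ) * Real.sin 1 * (Real.sin (Real.pi / 3) / (Real.pi / 3))) ^ 3 * (Real.sin (Real.pi / 3) / (Real.pi / 3)) ^ 2))⁻¹ + 1) *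
      ((HaarData.haar : Measure (Matrix.specialUnitaryGroup (Fin 2) ℂ)) {g | dist1 g < 1 / 3 + 1 / 21} ^ ((F.P K).L ^ ((F.P K).d - 1) - 1) /
        (HaarData.haar : Measure (Matrix.specialUnitaryGroup (Fin 2) ℂ)) {g | dist1 g < 1 / 21}) with hW
  have hW2 : 2 * W ≤ ENNReal.ofReal (1 / 10 ^ 14) := by
    rw [hW, hd, hPL]
    exact two_mul_kstar_record_mul_ratio_le_letters h4
  have hWtop : W ≠ ⊤ := by
    intro h
    rw [h, ENNReal.mul_top (by norm_num)] at hW2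
    exact absurd hW2 (by simp)
  have h2W : (2 * W).toReal = 2 * W.toReal := by
    rw [ENNReal.toReal_mul]; norm_num
  have hxle : 2 * W.toReal ≤ 1 / 10 ^ 14 := by
    rw [← h2W]; exact ENNReal.toReal_le_of_le_ofReal (by norm_num) hW2
  -- the two smallness rows at `x := 2·W.toReal`, `L` symbolic
  obtain ⟨hE, hG⟩ := smallness_T3_allL_of_ennreal_le h4 h20 hW2
  rw [h2W] at hE hG
  -- w8's record-range segment engine at `δ′ = 1/21`
  have hseg := map_iterFrom_le_exp_smul_su2_record (P := F.P K) (j := j) (n := n) hjn' hL400 (1 / 21) haarData_dist1_lt_one_div_ne_zero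
    (y := 9 / 10) (θ₀ := (1 + (9 / 10 : ℝ) ^ (F.L - 1)) / 2) (by norm_num) (by norm_num) hθ₀
    (by rw [← hW, hd, hPL]; exact hE) (by rw [← hW, hd, hPL]; exact hG)
  rw [← hW, hd, hPL] at hseg
  -- monotonicity of the exponent in `x ≤ 10⁻¹⁴`
  refine hseg.trans (Measure.le_iff.2 fun B _ => ?_)
  rw [Measure.smul_apply, Measure.smul_apply, smul_eq_mul, smul_eq_mul]
  refine mul_le_mul' (ENNReal.ofReal_le_ofReal (Real.exp_le_exp.mpr ?_)) le_rfl
  refine mul_le_mul_of_nonneg_left ?_ (Nat.cast_nonneg _)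
  exact mul_le_mul_of_nonneg_left (div_le_div_of_nonneg_right hxle (by positivity)) (M_pos hθ₀).le

/-! ## §2 The hTop row for every three-torus family with `4 ≤ L ≤ 20` -/

/-- ★★★ **THE TOP BLOCK-AVERAGING PUSH-FORWARD ROW FOR `4 ≤ L ≤ 20`**: ONE `c ≥ 0` (namely `c = 3·(2L^m)³ · M_L · 10⁻¹⁴/(9/10)^{5(L−1)}`, K-free by
✓`card_pBond_top`) with `(dU_j).map (iterFrom (blockAvg ℰp) j n) ≤ ofReal (exp c) • dU_{j+n}` for every `K` and every `j + n = K`.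
[cite: Balaban1985UV3, (2) p.256, (5) p.257; Balaban1987RG1, (0.4) p.253] -/
theorem topBlockAvgPushforward_of_le_twenty (F : T3Family) (h4 : 4 ≤ F.L) (h20 : F.L ≤ 20) :
    ∃ c : ℝ, 0 ≤ c ∧ ∀ (K j n : ℕ), j + n = K →
      (fieldMeasure (F.P K) j (Matrix.specialUnitaryGroup (Fin 2) ℂ)).map
          (iterFrom (fun i => blockAvg (P := F.P K) (G := Matrix.specialUnitaryGroup (Fin 2) ℂ) (j := i) ℰp) j n) ≤
        ENNReal.ofReal (Real.exp c) • fieldMeasure (F.P K) (j + n) (Matrix.specialUnitaryGroup (Fin 2) ℂ) := by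
  have hθ₀ : (1 + (9 / 10 : ℝ) ^ (F.L - 1)) / 2 < 1 := theta_allL_lt_one h4
  have hM0 : 0 < 2 / (1 - (1 + (9 / 10 : ℝ) ^ (F.L - 1)) / 2) := M_pos hθ₀
  refine ⟨((2 * F.L ^ F.m) ^ 3 * 3 : ℕ) *
      (2 / (1 - (1 + (9 / 10 : ℝ) ^ (F.L - 1)) / 2) * (1 / 10 ^ 14 / (9 / 10 : ℝ) ^ ((2 * 3 - 1) * (F.L - 1)))),
    by positivity, fun K j n hK => ?_⟩
  have h := map_iterFrom_blockAvg_le_exp_smul_allL F h4 h20 K j n (by omega)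
  have hcard : Fintype.card (PBond (F.P K) (j + n)) = (2 * F.L ^ F.m) ^ 3 * 3 := by
    rw [hK, card_pBond_top]
  rw [hcard] at h
  exact h

/-- ★★★★ **hTop FOR EVERY THREE-TORUS FAMILY WITH BLOCK SIZE `4 ≤ L ≤ 20`** in the crux lane's letter (the pinned family `avT3` IS `blockAvg ℰp` in range,
✓`iterFrom_avT3_eq_iterFrom_blockAvg`): `∃ c ≥ 0, ∀ K j n, j + n = K → (dU_j^{(K)}).map (iterFrom (avT3 F K) j n) ≤ ofReal (exp c) • dU_{j+n}^{(K)}`.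
[cite: Balaban1985UV3, (2) p.256, (5) p.257, (41) p.266; Balaban1987RG1, (0.4) p.253] -/
theorem topHaarPushforward_of_le_twenty (F : T3Family) (h4 : 4 ≤ F.L) (h20 : F.L ≤ 20) :
    ∃ c : ℝ, 0 ≤ c ∧ ∀ (K j n : ℕ), j + n = K →
      (fieldMeasure (F.P K) j (Matrix.specialUnitaryGroup (Fin 2) ℂ)).map (iterFrom (avT3 F K) j n) ≤
        ENNReal.ofReal (Real.exp c) • fieldMeasure (F.P K) (j + n) (Matrix.specialUnitaryGroup (Fin 2) ℂ) := by
  obtain ⟨c, hc0, hc⟩ := topBlockAvgPushforward_of_le_twenty F h4 h20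
  refine ⟨c, hc0, fun K j n hjn => ?_⟩
  rw [iterFrom_avT3_eq_iterFrom_blockAvg F K j n (by omega)]
  exact hc K j n hjn

/-! ## §3 Every block size the tree reaches: `3 ≤ L ≤ 20` -/

/-- ★★★★ **hTop FOR EVERY THREE-TORUS FAMILY WITH `3 ≤ L ≤ 20`** — w5 g19's ✓`topHaarPushforward_of_L_eq_three` (`L = 3`, the `K⋆` constant) ∨ §2
(`4 ≤ L ≤ 20`, the record constant).  Every block size any (H_K) supplier of the tree reaches; beyond `L = 20` none exists (FINDING #60 §2).
[cite: Balaban1985UV3, (2) p.256, (5) p.257, (41) p.266; Balaban1987RG1, (0.4) p.253] -/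
theorem topHaarPushforward_of_three_le (F : T3Family) (h3 : 3 ≤ F.L) (h20 : F.L ≤ 20) :
    ∃ c : ℝ, 0 ≤ c ∧ ∀ (K j n : ℕ), j + n = K →
      (fieldMeasure (F.P K) j (Matrix.specialUnitaryGroup (Fin 2) ℂ)).map (iterFrom (avT3 F K) j n) ≤
        ENNReal.ofReal (Real.exp c) • fieldMeasure (F.P K) (j + n) (Matrix.specialUnitaryGroup (Fin 2) ℂ) := by
  rcases Nat.eq_or_lt_of_le h3 with h | h
  · exact topHaarPushforward_of_L_eq_three F h.symm
  · exact topHaarPushforward_of_le_twenty F (by omega) h20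

/-- ★★★★ **ONE HYPOTHESIS**: the lower bound `3 ≤ F.L` is automatic for a three-torus family (`T3Family.hL : Odd L ∧ 1 < L` excludes `L = 2`), so hTop(F)
holds for EVERY `F : T3Family` with `F.L ≤ 20` (w8 g12's dock remark). [cite: Balaban1985UV3, (2) p.256, (5) p.257; Balaban1987RG1, (0.4) p.253] -/
theorem topHaarPushforward_of_T3_le_twenty (F : T3Family) (h20 : F.L ≤ 20) :
    ∃ c : ℝ, 0 ≤ c ∧ ∀ (K j n : ℕ), j + n = K →
      (fieldMeasure (F.P K) j (Matrix.specialUnitaryGroup (Fin 2) ℂ)).map (iterFrom (avT3 F K) j n) ≤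
        ENNReal.ofReal (Real.exp c) • fieldMeasure (F.P K) (j + n) (Matrix.specialUnitaryGroup (Fin 2) ℂ) := by
  refine topHaarPushforward_of_three_le F ?_ h20
  obtain ⟨hodd, h1⟩ := F.hL
  have h2 : F.L ≠ 2 := fun h => by
    rw [h] at hodd
    exact (Nat.not_odd_iff_even.2 (by decide)) hodd
  omega

end Summit.QuantumFields.YangMills.Theorems.UV3BranchExpansionHTopT3AllL

end
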